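import Mathlib
import HarnessLib
import Summits.ValiantsHypothesis.ValiantsHypothesis.Theorems.LacunarySymmetroidMatrixDescartesProductPlusOneOneRiserCalculus

/-!
# LINE (A) `product_plus_one` — one-riser interaction lemma, part 2: separation of the bottom coefficient and the zero count

Memo `pub/val-lit/lmr/NOTE-p7g15-18050-LINEA-incoherent-cell.md` §9 in kernel, analytic currency (crux item stmt-ValiantsHypothesis-18050,
LINE (A) floor structure; objects `momentS`, `psiFun`, `psiDeriv` from `…OneRiserDefs`, calculus from `…OneRiserCalculus`).
Data: exponents `p = e₁+1 < q = e₁+e₂+2`; ONE incoherent trinomial riser `a − b·x^p − c·x^q` (`b, c > 0`; the bottom coefficient `a` is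
free — it is SEPARATED) which is SWITCHED on the interval (`b x^p + c x^q > a`), and a nonempty cloud of binomial pullers with weights
`m_i > 0` and poles `z_i`, all UNSWITCHED on the interval (`x^p < z_i`).  With `Y = x^p`, `S₁ = momentS s m z 1`, `Ψ = psiFun s m z`,
`κ = p b/(q c)`:

* `strictMonoOn_Dhat` — `x ↦ p·T(x^p) − (q−p)·κ/(x^{q−p} + κ)` (`T = YΨ′/Ψ`) is strictly increasing (✓ `strictMonoOn_logDerivPsi`);
* ★ `levelFun_eq_at_most_twice` — the separated level function `M(x) = p·x^p·Ψ(x^p)·(1 + κ/x^{q−p})` takes each value at most twice on the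
  interval: `M′ = (M/x)·(p + p·T(x^p) − (q−p)κ/(x^{q−p}+κ))`, second factor strictly increasing (✓ `eq_at_most_twice_of_deriv_factor`);
* ★★ `oneRiser_no_four_zeros` — the total Euler ratio
  `Φ(x) = (p b x^p + q c x^q)/(b x^p + c x^q − a) − p·x^p·S₁(x^p)`
  does NOT vanish at four points `x₁ < x₂ < x₃ < x₄` of such an interval.  Proof: `Φ(x) = 0 ⟺ a = α(x)` with
  `α = b x^p + c x^q − (p b x^p + q c x^q)/(p x^p S₁(x^p))`, and `α′ = gα·(M − (q − p))` with `gα > 0`; four zeros give, by Rolle, three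
  points with `M = q − p` — one too many.  The count 3 is uniform in the exponents, in the number of pullers and in all coefficients.

The line-currency corollary (member of the class: riser row `(+,−,−)`, puller rows `(+,−,0)`, `eulerNumerator d a 0`) follows in
`…ProductPlusOneOneRiser`.  Honest framing: a located STRUCTURE lemma of the research floor (one riser, binomial pullers, one pole-free
interval where the riser is switched and the pullers are not) — a local count, not a global one; NOT `OneChangeFloorK3` / `stub_classRowK3` /
`stub_polyLaw` / `MatrixDescartes` / B; `VP ≠ VNP` NOT proved.  No definitions, no named facts; Mathlib only.
-/

set_option linter.dupNamespace false

namespace Summit.ValiantsHypothesis.ValiantsHypothesis.Theorems.LacunarySymmetroidMatrixDescartes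

namespace ProductPlusOne

open Finset
open scoped BigOperators

/-! ### §1 The separated level function `M` takes each value at most twice -/

section Riser

variable {ι : Type*} {s : Finset ι} {m z : ι → ℝ}

/-- **`D̂` is strictly increasing**: `x ↦ (e₁+1)·T(x^{e₁+1}) − (e₂+1)·κ/(x^{e₂+1} + κ)` on an interval of positive `x` with `x^{e₁+1} < z_min`.
[this file's lemma] -/
theorem strictMonoOn_Dhat (hs : s.Nonempty) (hm : ∀ i ∈ s, 0 < m i) (e₁ e₂ : ℕ) {κ lo hi : ℝ} (hκ : 0 < κ) (hlo : 0 < lo)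
    (hhi : ∀ i ∈ s, hi ^ (e₁ + 1) < z i) :
    StrictMonoOn (fun x : ℝ => ((e₁ : ℝ) + 1) * (x ^ (e₁ + 1) * psiDeriv s m z (x ^ (e₁ + 1)) / psiFun s m z (x ^ (e₁ + 1)))
      - ((e₂ : ℝ) + 1) * (κ / (x ^ (e₂ + 1) + κ))) (Set.Icc lo hi) := by
  intro x hx y hy hxy
  have hx0 : 0 < x := hlo.trans_le hx.1
  have hy0 : 0 < y := hlo.trans_le hy.1
  have hT' : x ^ (e₁ + 1) * psiDeriv s m z (x ^ (e₁ + 1)) / psiFun s m z (x ^ (e₁ + 1))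
      < y ^ (e₁ + 1) * psiDeriv s m z (y ^ (e₁ + 1)) / psiFun s m z (y ^ (e₁ + 1)) := by
    have hypow : y ^ (e₁ + 1) ≤ hi ^ (e₁ + 1) := pow_le_pow_left₀ hy0.le hy.2 _
    -- a common bound `Z'` with `hi^(e₁+1) < Z' ≤ z_i` for every `i` (the least pole), so that `T` is monotone on `(0, Z')`
    obtain ⟨i₀, hi₀⟩ := hs
    have hfin : ∃ Z' : ℝ, hi ^ (e₁ + 1) < Z' ∧ ∀ i ∈ s, Z' ≤ z i := by
      classical
      refine ⟨(s.image z).min' ((Finset.image_nonempty).2 ⟨i₀, hi₀⟩), ?_, ?_⟩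
      · obtain ⟨j, hj, hjeq⟩ := Finset.mem_image.1 (Finset.min'_mem (s.image z) ((Finset.image_nonempty).2 ⟨i₀, hi₀⟩))
        rw [← hjeq]; exact hhi j hj
      · intro i hi'
        exact Finset.min'_le _ _ (Finset.mem_image_of_mem z hi')
    obtain ⟨Z', hZ'1, hZ'2⟩ := hfin
    have hT2 := strictMonoOn_logDerivPsi (s := s) (m := m) (z := z) ⟨i₀, hi₀⟩ hm (zmin := Z') hZ'2
    exact hT2 ⟨pow_pos hx0 _, (pow_le_pow_left₀ hx0.le hx.2 _).trans_lt hZ'1⟩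
      ⟨pow_pos hy0 _, hypow.trans_lt hZ'1⟩ (pow_lt_pow_left₀ hxy hx0.le (by omega))
  have hfrac : κ / (y ^ (e₂ + 1) + κ) < κ / (x ^ (e₂ + 1) + κ) := by
    apply div_lt_div_of_pos_left hκ (by positivity)
    have := pow_lt_pow_left₀ hxy hx0.le (show e₂ + 1 ≠ 0 by omega)
    linarith
  have he1 : (0 : ℝ) < (e₁ : ℝ) + 1 := by positivity
  have he2 : (0 : ℝ) < (e₂ : ℝ) + 1 := by positivity
  nlinarith [mul_lt_mul_of_pos_left hT' he1, mul_lt_mul_of_pos_left hfrac he2]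

/-- ★ **The separated level function takes each value at most twice.**  `M(x) = (e₁+1)·x^{e₁+1}·Ψ(x^{e₁+1})·(1 + κ/x^{e₂+1})`
on `[lo, hi] ⊂ (0, ∞)` with `hi^{e₁+1} < z_i`: no three points `x₁ < x₂ < x₃` with equal values. [this file's theorem] -/
theorem levelFun_eq_at_most_twice (hs : s.Nonempty) (hm : ∀ i ∈ s, 0 < m i) (e₁ e₂ : ℕ) {κ lo hi : ℝ} (hκ : 0 < κ)
    (hlo : 0 < lo) (hhi : ∀ i ∈ s, hi ^ (e₁ + 1) < z i) {x₁ x₂ x₃ : ℝ} (h1 : lo ≤ x₁) (h12 : x₁ < x₂) (h23 : x₂ < x₃)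
    (h3 : x₃ ≤ hi)
    (e12 : ((e₁ : ℝ) + 1) * x₁ ^ (e₁ + 1) * psiFun s m z (x₁ ^ (e₁ + 1)) * (1 + κ / x₁ ^ (e₂ + 1))
      = ((e₁ : ℝ) + 1) * x₂ ^ (e₁ + 1) * psiFun s m z (x₂ ^ (e₁ + 1)) * (1 + κ / x₂ ^ (e₂ + 1)))
    (e23 : ((e₁ : ℝ) + 1) * x₂ ^ (e₁ + 1) * psiFun s m z (x₂ ^ (e₁ + 1)) * (1 + κ / x₂ ^ (e₂ + 1))
      = ((e₁ : ℝ) + 1) * x₃ ^ (e₁ + 1) * psiFun s m z (x₃ ^ (e₁ + 1)) * (1 + κ / x₃ ^ (e₂ + 1))) : False := by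
  set M : ℝ → ℝ := fun x => ((e₁ : ℝ) + 1) * x ^ (e₁ + 1) * psiFun s m z (x ^ (e₁ + 1)) * (1 + κ / x ^ (e₂ + 1)) with hM
  set D : ℝ → ℝ := fun x => ((e₁ : ℝ) + 1)
      + (((e₁ : ℝ) + 1) * (x ^ (e₁ + 1) * psiDeriv s m z (x ^ (e₁ + 1)) / psiFun s m z (x ^ (e₁ + 1)))
        - ((e₂ : ℝ) + 1) * (κ / (x ^ (e₂ + 1) + κ))) with hD
  set g : ℝ → ℝ := fun x => M x / x with hg
  have hYlt : ∀ x ∈ Set.Icc lo hi, ∀ i ∈ s, x ^ (e₁ + 1) < z i := fun x hx i hi' =>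
    (pow_le_pow_left₀ (hlo.trans_le hx.1).le hx.2 _).trans_lt (hhi i hi')
  -- derivative of M in factored form
  have hderM : ∀ x ∈ Set.Icc lo hi, ∃ f' : ℝ, HasDerivAt M f' x ∧ f' = g x * D x := by
    intro x hx
    have hx0 : 0 < x := hlo.trans_le hx.1
    have hxne : x ≠ 0 := hx0.ne'
    have hYi := hYlt x hx
    have hΨpos := psiFun_pos hs hm hYi
    -- pieces
    have hA : HasDerivAt (fun t : ℝ => t ^ (e₁ + 1)) (((e₁ + 1 : ℕ) : ℝ) * x ^ e₁) x := by
      simpa using hasDerivAt_pow (e₁ + 1) x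
    have hB : HasDerivAt (fun t : ℝ => psiFun s m z (t ^ (e₁ + 1))) (psiDeriv s m z (x ^ (e₁ + 1)) * (((e₁ + 1 : ℕ) : ℝ) * x ^ e₁)) x :=
      HasDerivAt.comp (h₂ := psiFun s m z) (h := fun t : ℝ => t ^ (e₁ + 1)) x (hasDerivAt_psiFun hs hm hYi) hA
    have hC : HasDerivAt (fun t : ℝ => 1 + κ / t ^ (e₂ + 1)) (κ * (-(((e₂ + 1 : ℕ) : ℝ) * x ^ e₂) / (x ^ (e₂ + 1)) ^ 2)) x := by
      have hp : HasDerivAt (fun t : ℝ => t ^ (e₂ + 1)) (((e₂ + 1 : ℕ) : ℝ) * x ^ e₂) x := by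
        simpa using hasDerivAt_pow (e₂ + 1) x
      have hinv := (hp.inv (pow_ne_zero _ hxne)).const_mul κ
      have hinv' : HasDerivAt (fun t : ℝ => κ / t ^ (e₂ + 1)) (κ * (-(((e₂ + 1 : ℕ) : ℝ) * x ^ e₂) / (x ^ (e₂ + 1)) ^ 2)) x :=
        hinv.congr_of_eventuallyEq (Filter.Eventually.of_forall fun t => by simp [div_eq_mul_inv])
      exact hinv'.const_add 1
    have hABC := ((hA.mul hB).mul hC).const_mul ((e₁ : ℝ) + 1)
    refine ⟨_, hABC.congr_of_eventuallyEq (Filter.Eventually.of_forall fun t => ?_), ?_⟩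
    · simp only [hM, Pi.mul_apply]; ring
    · simp only [hg, hD, hM, Pi.mul_apply]
      push_cast
      field_simp
      ring
  have hgpos : ∀ x ∈ Set.Icc lo hi, 0 < g x := by
    intro x hx
    have hx0 : 0 < x := hlo.trans_le hx.1
    have hΨ := psiFun_pos hs hm (hYlt x hx)
    simp only [hg, hM]
    positivity
  have hDmono : StrictMonoOn D (Set.Icc lo hi) := by
    have h := strictMonoOn_Dhat (s := s) (m := m) (z := z) hs hm e₁ e₂ hκ hlo hhi
    intro x hx y hy hxy
    have := h hx hy hxy
    simp only [hD]
    linarith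
  exact eq_at_most_twice_of_deriv_factor hderM hgpos hDmono h1 h12 h23 h3 e12 e23

end Riser

/-! ### §2 The one-riser interaction lemma (analytic form) -/

section Main

variable {ι : Type*} {s : Finset ι} {m z : ι → ℝ}

/-- ★★ **THE ONE-RISER INTERACTION LEMMA (analytic form).**  Exponents `p = e₁+1 < q = e₁+e₂+2`; a switched incoherent riser `a − b Y − c x^q`
(`b, c > 0`, `Y = x^p`, `b Y + c x^q > a` on the interval) and a nonempty cloud of unswitched binomial pullers (`m_i > 0`, `Y < z_i`): the total Euler
ratio `Φ(x) = (p b x^p + q c x^q)/(b x^p + c x^q − a) − p·x^p·S₁(x^p)` does NOT vanish at four points `x₁ < x₂ < x₃ < x₄` of the interval.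
[this file's theorem] -/
theorem oneRiser_no_four_zeros (hs : s.Nonempty) (hm : ∀ i ∈ s, 0 < m i) (e₁ e₂ : ℕ) {a b c : ℝ} (hb : 0 < b) (hc : 0 < c)
    {x₁ x₂ x₃ x₄ : ℝ} (h0 : 0 < x₁) (h12 : x₁ < x₂) (h23 : x₂ < x₃) (h34 : x₃ < x₄)
    (hsw : ∀ x ∈ Set.Icc x₁ x₄, a < b * x ^ (e₁ + 1) + c * x ^ (e₁ + e₂ + 2))
    (hun : ∀ i ∈ s, x₄ ^ (e₁ + 1) < z i)
    (hzero : ∀ x ∈ ({x₁, x₂, x₃, x₄} : Set ℝ),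
      (((e₁ : ℝ) + 1) * b * x ^ (e₁ + 1) + ((e₁ : ℝ) + e₂ + 2) * c * x ^ (e₁ + e₂ + 2))
          / (b * x ^ (e₁ + 1) + c * x ^ (e₁ + e₂ + 2) - a)
        - ((e₁ : ℝ) + 1) * x ^ (e₁ + 1) * momentS s m z 1 (x ^ (e₁ + 1)) = 0) : False := by
  -- shorthand
  set pR : ℝ := (e₁ : ℝ) + 1 with hpR
  set qR : ℝ := (e₁ : ℝ) + e₂ + 2 with hqR
  have hpR0 : 0 < pR := by rw [hpR]; positivity
  have hqR0 : 0 < qR := by rw [hqR]; positivity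
  set κ : ℝ := pR * b / (qR * c) with hκ
  have hκ0 : 0 < κ := by rw [hκ]; positivity
  set α : ℝ → ℝ := fun x => b * x ^ (e₁ + 1) + c * x ^ (e₁ + e₂ + 2)
      - (pR * b * x ^ (e₁ + 1) + qR * c * x ^ (e₁ + e₂ + 2)) / (pR * x ^ (e₁ + 1) * momentS s m z 1 (x ^ (e₁ + 1))) with hαdef
  set M : ℝ → ℝ := fun x => pR * x ^ (e₁ + 1) * psiFun s m z (x ^ (e₁ + 1)) * (1 + κ / x ^ (e₂ + 1)) with hMdef
  set gα : ℝ → ℝ := fun x => qR * c * x ^ (e₁ + e₂ + 1) / (pR * x ^ (e₁ + 1) * momentS s m z 1 (x ^ (e₁ + 1))) with hgα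
  have hYlt : ∀ x ∈ Set.Icc x₁ x₄, ∀ i ∈ s, x ^ (e₁ + 1) < z i := fun x hx i hi =>
    (pow_le_pow_left₀ (h0.trans_le hx.1).le hx.2 _).trans_lt (hun i hi)
  -- (1) at a zero of Φ, `α = a`
  have hαa : ∀ x ∈ Set.Icc x₁ x₄,
      (pR * b * x ^ (e₁ + 1) + qR * c * x ^ (e₁ + e₂ + 2)) / (b * x ^ (e₁ + 1) + c * x ^ (e₁ + e₂ + 2) - a)
        - pR * x ^ (e₁ + 1) * momentS s m z 1 (x ^ (e₁ + 1)) = 0 → α x = a := by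
    intro x hx hz
    have hx0 : 0 < x := h0.trans_le hx.1
    have hh : 0 < b * x ^ (e₁ + 1) + c * x ^ (e₁ + e₂ + 2) - a := by linarith [hsw x hx]
    have hS1 := momentS_pos s m z hs hm 1 (hYlt x hx)
    have hN : 0 < pR * x ^ (e₁ + 1) * momentS s m z 1 (x ^ (e₁ + 1)) := by positivity
    have hP1 : 0 < pR * b * x ^ (e₁ + 1) + qR * c * x ^ (e₁ + e₂ + 2) := by positivity
    -- from `P1/h = N`: `P1 = N h`, so `a = U − P1/N`
    have e1 : pR * b * x ^ (e₁ + 1) + qR * c * x ^ (e₁ + e₂ + 2)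
        = (pR * x ^ (e₁ + 1) * momentS s m z 1 (x ^ (e₁ + 1))) * (b * x ^ (e₁ + 1) + c * x ^ (e₁ + e₂ + 2) - a) := by
      have := sub_eq_zero.1 hz
      field_simp at this
      linarith
    simp only [hαdef]
    rw [e1]
    field_simp
    ring
  -- (2) the derivative of α in factored form
  have hderα : ∀ x ∈ Set.Icc x₁ x₄, ∃ f' : ℝ, HasDerivAt α f' x ∧ f' = gα x * (M x - (qR - pR)) := by
    intro x hx
    have hx0 : 0 < x := h0.trans_le hx.1
    have hxne : x ≠ 0 := hx0.ne'
    have hYi := hYlt x hx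
    have hS1pos := momentS_pos s m z hs hm 1 hYi
    have hS1ne := hS1pos.ne'
    -- powers
    have hp1 : HasDerivAt (fun t : ℝ => t ^ (e₁ + 1)) (((e₁ + 1 : ℕ) : ℝ) * x ^ e₁) x := by
      simpa using hasDerivAt_pow (e₁ + 1) x
    have hp2 : HasDerivAt (fun t : ℝ => t ^ (e₁ + e₂ + 2)) (((e₁ + e₂ + 2 : ℕ) : ℝ) * x ^ (e₁ + e₂ + 1)) x := by
      simpa using hasDerivAt_pow (e₁ + e₂ + 2) x
    -- `S₁ ∘ pow`
    have hS1Y : HasDerivAt (momentS s m z 1) (momentS s m z 2 (x ^ (e₁ + 1))) (x ^ (e₁ + 1)) := by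
      simpa using hasDerivAt_momentS' s m z 0 hYi
    have hS1 : HasDerivAt (fun t : ℝ => momentS s m z 1 (t ^ (e₁ + 1))) (momentS s m z 2 (x ^ (e₁ + 1)) * (((e₁ + 1 : ℕ) : ℝ) * x ^ e₁)) x :=
      HasDerivAt.comp (h₂ := momentS s m z 1) (h := fun t : ℝ => t ^ (e₁ + 1)) x hS1Y hp1
    have hU : HasDerivAt (fun t : ℝ => b * t ^ (e₁ + 1) + c * t ^ (e₁ + e₂ + 2))
        (b * (((e₁ + 1 : ℕ) : ℝ) * x ^ e₁) + c * (((e₁ + e₂ + 2 : ℕ) : ℝ) * x ^ (e₁ + e₂ + 1))) x :=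
      (hp1.const_mul b).add (hp2.const_mul c)
    have hP : HasDerivAt (fun t : ℝ => pR * b * t ^ (e₁ + 1) + qR * c * t ^ (e₁ + e₂ + 2))
        (pR * b * (((e₁ + 1 : ℕ) : ℝ) * x ^ e₁) + qR * c * (((e₁ + e₂ + 2 : ℕ) : ℝ) * x ^ (e₁ + e₂ + 1))) x :=
      (hp1.const_mul (pR * b)).add (hp2.const_mul (qR * c))
    have hN : HasDerivAt (fun t : ℝ => pR * t ^ (e₁ + 1) * momentS s m z 1 (t ^ (e₁ + 1)))
        (pR * ((((e₁ + 1 : ℕ) : ℝ) * x ^ e₁) * momentS s m z 1 (x ^ (e₁ + 1))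
          + x ^ (e₁ + 1) * (momentS s m z 2 (x ^ (e₁ + 1)) * (((e₁ + 1 : ℕ) : ℝ) * x ^ e₁)))) x := by
      have := (hp1.mul hS1).const_mul pR
      refine this.congr_of_eventuallyEq (Filter.Eventually.of_forall fun t => ?_)
      simp only [Pi.mul_apply]; ring
    have hNne : pR * x ^ (e₁ + 1) * momentS s m z 1 (x ^ (e₁ + 1)) ≠ 0 := by positivity
    have hquot := hP.div hN hNne
    have hall : HasDerivAt (fun t : ℝ => b * t ^ (e₁ + 1) + c * t ^ (e₁ + e₂ + 2)
        - (pR * b * t ^ (e₁ + 1) + qR * c * t ^ (e₁ + e₂ + 2)) / (pR * t ^ (e₁ + 1) * momentS s m z 1 (t ^ (e₁ + 1)))) _ x :=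
      hU.sub hquot
    refine ⟨_, by rw [hαdef]; exact hall, ?_⟩
    simp only [hgα, hMdef, psiFun]
    have hx2 : x ^ (e₂ + 1) ≠ 0 := pow_ne_zero _ hxne
    rw [hκ, hpR, hqR]
    push_cast
    field_simp
    ring
  have hgαpos : ∀ x ∈ Set.Icc x₁ x₄, 0 < gα x := by
    intro x hx
    have hx0 : 0 < x := h0.trans_le hx.1
    have := momentS_pos s m z hs hm 1 (hYlt x hx)
    simp only [hgα]
    positivity
  -- (3) Rolle on α three times: critical points ξ₁ < ξ₂ < ξ₃ with `M = q − p`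
  have hmem : ∀ x, x = x₁ ∨ x = x₂ ∨ x = x₃ ∨ x = x₄ → x ∈ ({x₁, x₂, x₃, x₄} : Set ℝ) := by
    intro x h; simp only [Set.mem_insert_iff, Set.mem_singleton_iff]; tauto
  have hI : ∀ x, x₁ ≤ x → x ≤ x₄ → x ∈ Set.Icc x₁ x₄ := fun x h1 h2 => ⟨h1, h2⟩
  have ha1 : α x₁ = a := hαa x₁ (hI x₁ le_rfl (by linarith)) (hzero x₁ (hmem x₁ (Or.inl rfl)))
  have ha2 : α x₂ = a := hαa x₂ (hI x₂ h12.le (by linarith)) (hzero x₂ (hmem x₂ (Or.inr (Or.inl rfl))))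
  have ha3 : α x₃ = a := hαa x₃ (hI x₃ (by linarith) h34.le) (hzero x₃ (hmem x₃ (Or.inr (Or.inr (Or.inl rfl)))))
  have ha4 : α x₄ = a := hαa x₄ (hI x₄ (by linarith) le_rfl) (hzero x₄ (hmem x₄ (Or.inr (Or.inr (Or.inr rfl)))))
  have hcont : ∀ u v, x₁ ≤ u → v ≤ x₄ → ContinuousOn α (Set.Icc u v) := fun u v hu hv x hx => by
    obtain ⟨f', hf', _⟩ := hderα x ⟨hu.trans hx.1, hx.2.trans hv⟩
    exact hf'.continuousAt.continuousWithinAt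
  have hcrit : ∀ u v, x₁ ≤ u → u < v → v ≤ x₄ → α u = α v → ∃ ξ, u < ξ ∧ ξ < v ∧ M ξ = qR - pR := by
    intro u v hu huv hv huv'
    obtain ⟨ξ, hξ, hξ'⟩ := exists_deriv_eq_zero huv (hcont u v hu hv) huv'
    have hξI : ξ ∈ Set.Icc x₁ x₄ := ⟨hu.trans hξ.1.le, hξ.2.le.trans hv⟩
    obtain ⟨f', hf', ef'⟩ := hderα ξ hξI
    rw [hf'.deriv] at hξ'
    rw [hξ'] at ef'
    refine ⟨ξ, hξ.1, hξ.2, ?_⟩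
    rcases mul_eq_zero.1 ef'.symm with h | h
    · exact absurd h (hgαpos ξ hξI).ne'
    · linarith
  obtain ⟨ξ₁, h1l, h1r, hM1⟩ := hcrit x₁ x₂ le_rfl h12 (by linarith) (ha1.trans ha2.symm)
  obtain ⟨ξ₂, h2l, h2r, hM2⟩ := hcrit x₂ x₃ h12.le h23 (by linarith) (ha2.trans ha3.symm)
  obtain ⟨ξ₃, h3l, h3r, hM3⟩ := hcrit x₃ x₄ (by linarith) h34 le_rfl (ha3.trans ha4.symm)
  -- (4) `M` takes the value `q − p` three times: impossible
  exact levelFun_eq_at_most_twice (s := s) (m := m) (z := z) hs hm e₁ e₂ hκ0 h0 hun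
    (x₁ := ξ₁) (x₂ := ξ₂) (x₃ := ξ₃) h1l.le (h1r.trans h2l) (h2r.trans h3l) h3r.le
    (by simp only [hMdef] at hM1 hM2; rw [hM1, hM2]) (by simp only [hMdef] at hM2 hM3; rw [hM2, hM3])

end Main

end ProductPlusOne

end Summit.ValiantsHypothesis.ValiantsHypothesis.Theorems.LacunarySymmetroidMatrixDescartes
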